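import Summits.BirchSwinnertonDyer.BirchSwinnertonDyer.Theorems.UniversalToricDescentThinCombFrameFunctionalEquation
import Summits.BirchSwinnertonDyer.BirchSwinnertonDyer.Theorems.UniversalToricDescentRationalSplitIMCInclusionAtThreeClosedModuloPrint
import HarnessLib

/-!
# The rational wall `RationalSplitIMCInclusionAtThree` (stmt-BirchSwinnertonDyer-24207) CLOSED MODULO {(E) BARE existence of a ♯♯-frame,
# Jacquet's cone fact, Nekovář's fact, K2-rat} — the NORMALISATION (N)/(N♭) of stub 1 is REMOVED BY PROOF
# (certificate `V87`, `--supports stmt-BirchSwinnertonDyer-24207`; cell `pub/bsd-wall`, LEAD `cruxlead-24207` g38)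

WHY THIS FILE. Since v8.2 the composition of the line `ratwall_thin_comb` consumes its first stub in the form `stub_toricExistsSymmUpTo2` =
(i) a ♯♯-frame `L₂` with constants `(C, X, Y)` ∧ (ii) `Associated (φ_{A_τ} L₂) L₂` for the frame involution `A_τ`. Certificates V83–V86 derived
(ii) from (i) only for frames with NORMALISED second grading (`Y = X·κ̂`, (N); `Y ∈ X·κ̂·ℤ₃ˣ`, (N♭)), which is why the v8.3–v10 stub 1 was the
normalised existence. The FRAME FUNCTIONAL EQUATION `…ThinComb.FrameFunctionalEquation.associated_frameSubst` (g38) proves (ii) for EVERY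
♯♯-frame. Hence:

* `toricExistsSymmUpTo2_of_exists_of_jacquet hE hJ` : the v8.2 stub 1 VERBATIM from (E) = the BARE existence of a ♯♯-frame (the v5/v6 stub
  `stub_toricExistsUpTo2` VERBATIM; named `…ToricFrameExistsDefs.ToricFrameExistsAtThree` in the light defs module of this gen) and Jacquet's
  cone fact ALONE;
* `RationalSplitIMCInclusionAtThree_of_exists_of_jacquet_of_nekovar_of_ratCombDvd` : the crux BY NAME from (E) + Jacquet + Nekovář + K2-rat
  (item 32493's text), through `…ClosedModuloPrint.RationalSplitIMCInclusionAtThree_of_toricExistsSymm_of_nekovar_of_ratCombDvd`;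
* `toricFrameExists_of_normalisedUpToUnit` : (N♭) ⟹ (E) (the new stub is WEAKER than v10's, trivially).

So the residue of the crux reads (skeleton v11): (E) [adaptation of Hida 1988 Thm. 5.1b ⊗ Castella–Wan 2.11 at the additive split 3 — existence
of an INTEGRAL two-variable interpolation with SOME constants; no normalisation, no functional equation asked] ⊕ PRINT {Jacquet 1972 (typed),
Nekovář 2006 (typed)} ⊕ RESEARCH {K2-rat, item 32493}. HONEST SCOPE: none of the four inputs is proved here; nothing here is evidence that a toric
frame exists at the additive split `3`; BSD is proved for no curve; 24207 / 20395 / 20186 / 32493 OPEN.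

References: [cite: Jacquet1972, §19 Thm. 19.14, Cor. 19.15] [cite: Tate1979, (3.1), (3.2.3), (3.4)] [cite: Hida1988AIF, §5 Thm. 5.1b]
[cite: BuyukbodukLei2017, §2.4 Thm. 2.18, Def. 3.8 (arXiv:1707.00557)] [cite: CastellaWan2023, §2.4 Thm. 2.11 (arXiv:1607.02019)]
[cite: Nekovar2006, Thm. 8.9.9, Prop. 9.6.6 (ii)] [cite: Gu2025FiniteSlopeUniversalRS, Conj. 2.15 (arXiv:2512.01184)] [cite: HaoLoeffler2025, §4 Thm. 4.9]
-/

set_option linter.dupNamespace false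
set_option autoImplicit false

noncomputable section

open scoped Classical MatrixGroups

namespace Summit.BirchSwinnertonDyer.BirchSwinnertonDyer.Theorems.UniversalToricDescentRatwallThinCombLine.V87

open NumberField IsDedekindDomain Field
open Literature.NumberTheory.EllipticCurves Literature.NumberTheory.GaloisRepresentations
open Literature.NumberTheory.EllipticCurves.ModularForms
open Summit.BirchSwinnertonDyer.BirchSwinnertonDyer.Theorems.UniversalToricDescentThinComb

/-- **Stub 1 of the line (v8.2 signature VERBATIM) from the BARE existence (E) of a ♯♯-frame and Jacquet's functional equation on the cone BY
NAME**: clause (ii) `Associated (φ_{A_τ} L₂) L₂` holds for EVERY frame (`…ThinComb.FrameFunctionalEquation.associated_frameSubst`).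
[cite: Jacquet1972, §19 Thm. 19.14, Cor. 19.15] [cite: Hida1988AIF, §5 Thm. 5.1b] [cite: BuyukbodukLei2017, Def. 3.8 (arXiv:1707.00557)]
[cite: HaoLoeffler2025, §4 Thm. 4.9 (arXiv:2405.12611)] -/
theorem toricExistsSymmUpTo2_of_exists_of_jacquet
    (hE :
        ∀ (W : WeierstrassCurve ℚ) [W.IsElliptic] [W.IsGloballyMinimal] (N : ℕ) [NeZero N] (K : Type) [Field K]
          [NumberField K] (Dt : Literature.NumberTheory.EllipticCurves.ModularForms.ModularParametrizationData W N),
        Summit.BirchSwinnertonDyer.Rank1Residual.Additive.ClassO6 W 3 → W.HasSurjectiveModNGaloisRep 3 →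
        W.analyticRank = 1 → W.conductorNorm ℤ = N → IsImaginaryQuadratic K → SatisfiesHeegnerHypothesis N K →
        ∀ (κ' : ZpExtension K 3), κ'.IsAnticyclotomic → ∀ (γ : Field.absoluteGaloisGroup K) [Fact (κ'.IsTopGenerator γ)]
          (𝔭 : HeightOneSpectrum (𝓞 K)), ((3 : ℕ) : 𝓞 K) ∈ 𝔭.asIdeal →
          𝔭.asIdeal.ramificationIdx (𝓞 ℚ) = 1 → 𝔭.asIdeal.inertiaDeg (𝓞 ℚ) = 1 →
        ∀ (𝔭' : HeightOneSpectrum (𝓞 K)), ((3 : ℕ) : 𝓞 K) ∈ 𝔭'.asIdeal → 𝔭' ≠ 𝔭 →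
        ∀ (ι' : PadicAlgCl 3 ≃+* ℂ), Summit.BirchSwinnertonDyer.BirchSwinnertonDyer.Theorems.SchneiderFree.BranchInducesPrime 3 ι' 𝔭 →
        ∀ (κ₁ κ₂ : ZpExtension K 3) (γ₁ γ₂ : Field.absoluteGaloisGroup K) (k : ℕ)
          [Fact (ZpExtension.IsTopGeneratorPair κ₁ κ₂ γ₁ γ₂)],
        (∀ v : HeightOneSpectrum (𝓞 K), v ≠ 𝔭 → ∀ 𝔓 ∈ v.primesAbove,
            𝔓.inertia (Field.absoluteGaloisGroup K) ≤ κ₁.kerSubgroup) →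
        ZpExtension.pairKer κ₁ κ₂ ≤ κ'.kerSubgroup → γ₁ * γ⁻¹ ∈ κ'.kerSubgroup → γ₂ * (γ ^ (3 ^ k))⁻¹ ∈ κ'.kerSubgroup →
        ∃ (ΩK' : ℂ) (C X Y : ℂ_[3]) (L₂ : PowerSeries (PowerSeries (unrIntegers 3))),
          ΩK' ≠ 0 ∧ C ≠ 0 ∧ X ≠ 0 ∧ Y ≠ 0 ∧
          IsToricTwoVarLFunctionUpTo₂ C X Y ι' 𝔭 𝔭' κ₁ κ₂ γ₁ γ₂ Dt.f ΩK' L₂)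
    (hJ : Literature.NumberTheory.EllipticCurves.jacquet1972_functionalEquation_rankinSelbergHecke_cone) :
    ∀ (W : WeierstrassCurve ℚ) [W.IsElliptic] [W.IsGloballyMinimal] (N : ℕ) [NeZero N] (K : Type) [Field K]
      [NumberField K] (Dt : Literature.NumberTheory.EllipticCurves.ModularForms.ModularParametrizationData W N),
    Summit.BirchSwinnertonDyer.Rank1Residual.Additive.ClassO6 W 3 → W.HasSurjectiveModNGaloisRep 3 →
    W.analyticRank = 1 → W.conductorNorm ℤ = N → IsImaginaryQuadratic K → SatisfiesHeegnerHypothesis N K →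
    ∀ (κ' : ZpExtension K 3), κ'.IsAnticyclotomic → ∀ (γ : Field.absoluteGaloisGroup K) [Fact (κ'.IsTopGenerator γ)]
      (𝔭 : HeightOneSpectrum (𝓞 K)), ((3 : ℕ) : 𝓞 K) ∈ 𝔭.asIdeal →
      𝔭.asIdeal.ramificationIdx (𝓞 ℚ) = 1 → 𝔭.asIdeal.inertiaDeg (𝓞 ℚ) = 1 →
    ∀ (𝔭' : HeightOneSpectrum (𝓞 K)), ((3 : ℕ) : 𝓞 K) ∈ 𝔭'.asIdeal → 𝔭' ≠ 𝔭 →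
    ∀ (ι' : PadicAlgCl 3 ≃+* ℂ), Summit.BirchSwinnertonDyer.BirchSwinnertonDyer.Theorems.SchneiderFree.BranchInducesPrime 3 ι' 𝔭 →
    ∀ (κ₁ κ₂ : ZpExtension K 3) (γ₁ γ₂ : Field.absoluteGaloisGroup K) (k : ℕ)
      [Fact (ZpExtension.IsTopGeneratorPair κ₁ κ₂ γ₁ γ₂)],
    (∀ v : HeightOneSpectrum (𝓞 K), v ≠ 𝔭 → ∀ 𝔓 ∈ v.primesAbove,
        𝔓.inertia (Field.absoluteGaloisGroup K) ≤ κ₁.kerSubgroup) →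
    ZpExtension.pairKer κ₁ κ₂ ≤ κ'.kerSubgroup → γ₁ * γ⁻¹ ∈ κ'.kerSubgroup → γ₂ * (γ ^ (3 ^ k))⁻¹ ∈ κ'.kerSubgroup →
    ∃ (ΩK' : ℂ) (C X Y : ℂ_[3]) (L₂ : PowerSeries (PowerSeries (unrIntegers 3))),
      ΩK' ≠ 0 ∧ C ≠ 0 ∧ X ≠ 0 ∧ Y ≠ 0 ∧
      IsToricTwoVarLFunctionUpTo₂ C X Y ι' 𝔭 𝔭' κ₁ κ₂ γ₁ γ₂ Dt.f ΩK' L₂ ∧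
      ∀ (c : Field.absoluteGaloisGroup ℚ), c ∉ Set.range (absGaloisRestrict ℚ K) →
      ∀ (τ : Field.absoluteGaloisGroup K → Field.absoluteGaloisGroup K),
        (∀ σ, absGaloisRestrict ℚ K (τ σ) = c * (absGaloisRestrict ℚ K σ)⁻¹ * c⁻¹) →
      ∀ (A : GL (Fin 2) ℤ_[3]), (A : Matrix (Fin 2) (Fin 2) ℤ_[3]) = IwasawaAlgebra₂.frameMatrixOf κ₁ κ₂ γ₁ γ₂ τ →
        letI : Algebra ℤ_[3] (unrIntegers 3) := (Summit.BirchSwinnertonDyer.Rank1Residual.X11b.Halves.toUnr 3).toAlgebra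
        Associated (IwasawaAlgebra₂.frameSubst (unrIntegers 3) A L₂) L₂ := by
  intro W _ _ N _ K _ _ Dt hO6 hsurj hrk hN' hK hH κ' hκ' γ hγ 𝔭 h3 hram hdeg 𝔭' h3' hne ι' hι κ₁ κ₂ γ₁ γ₂ k hpair hur₁ hker hγ₁ hγ₂
  obtain ⟨ΩK', C, X, Y, L₂, hΩK', hC, hX, hY, hL₂⟩ :=
    hE W N K Dt hO6 hsurj hrk hN' hK hH κ' hκ' γ 𝔭 h3 hram hdeg 𝔭' h3' hne ι' hι κ₁ κ₂ γ₁ γ₂ k hur₁ hker hγ₁ hγ₂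
  refine ⟨ΩK', C, X, Y, L₂, hΩK', hC, hX, hY, hL₂, ?_⟩
  intro c hc τ hτ A hA
  exact FrameFunctionalEquation.associated_frameSubst hJ hK W Dt hH h3 h3' hne ι' hι hpair.out hur₁ hc hτ A hA hX hY hL₂

/-- **THE CRUX BY NAME from (E), Jacquet's cone fact, Nekovář's fact and `stub_ratCombDvdUpTo2`** (the text of item stmt-BirchSwinnertonDyer-32493),
through `…ClosedModuloPrint.RationalSplitIMCInclusionAtThree_of_toricExistsSymm_of_nekovar_of_ratCombDvd`. [cite: Jacquet1972, §19 Thm. 19.14, Cor. 19.15]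
[cite: Nekovar2006, Thm. 8.9.9, Prop. 9.6.6 (ii)] [cite: Gu2025FiniteSlopeUniversalRS, Conj. 2.15 (arXiv:2512.01184)] [cite: Hida1988AIF, §5 Thm. 5.1b] -/
theorem RationalSplitIMCInclusionAtThree_of_exists_of_jacquet_of_nekovar_of_ratCombDvd
    (hE :
        ∀ (W : WeierstrassCurve ℚ) [W.IsElliptic] [W.IsGloballyMinimal] (N : ℕ) [NeZero N] (K : Type) [Field K]
          [NumberField K] (Dt : Literature.NumberTheory.EllipticCurves.ModularForms.ModularParametrizationData W N),
        Summit.BirchSwinnertonDyer.Rank1Residual.Additive.ClassO6 W 3 → W.HasSurjectiveModNGaloisRep 3 →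
        W.analyticRank = 1 → W.conductorNorm ℤ = N → IsImaginaryQuadratic K → SatisfiesHeegnerHypothesis N K →
        ∀ (κ' : ZpExtension K 3), κ'.IsAnticyclotomic → ∀ (γ : Field.absoluteGaloisGroup K) [Fact (κ'.IsTopGenerator γ)]
          (𝔭 : HeightOneSpectrum (𝓞 K)), ((3 : ℕ) : 𝓞 K) ∈ 𝔭.asIdeal →
          𝔭.asIdeal.ramificationIdx (𝓞 ℚ) = 1 → 𝔭.asIdeal.inertiaDeg (𝓞 ℚ) = 1 →
        ∀ (𝔭' : HeightOneSpectrum (𝓞 K)), ((3 : ℕ) : 𝓞 K) ∈ 𝔭'.asIdeal → 𝔭' ≠ 𝔭 →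
        ∀ (ι' : PadicAlgCl 3 ≃+* ℂ), Summit.BirchSwinnertonDyer.BirchSwinnertonDyer.Theorems.SchneiderFree.BranchInducesPrime 3 ι' 𝔭 →
        ∀ (κ₁ κ₂ : ZpExtension K 3) (γ₁ γ₂ : Field.absoluteGaloisGroup K) (k : ℕ)
          [Fact (ZpExtension.IsTopGeneratorPair κ₁ κ₂ γ₁ γ₂)],
        (∀ v : HeightOneSpectrum (𝓞 K), v ≠ 𝔭 → ∀ 𝔓 ∈ v.primesAbove,
            𝔓.inertia (Field.absoluteGaloisGroup K) ≤ κ₁.kerSubgroup) →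
        ZpExtension.pairKer κ₁ κ₂ ≤ κ'.kerSubgroup → γ₁ * γ⁻¹ ∈ κ'.kerSubgroup → γ₂ * (γ ^ (3 ^ k))⁻¹ ∈ κ'.kerSubgroup →
        ∃ (ΩK' : ℂ) (C X Y : ℂ_[3]) (L₂ : PowerSeries (PowerSeries (unrIntegers 3))),
          ΩK' ≠ 0 ∧ C ≠ 0 ∧ X ≠ 0 ∧ Y ≠ 0 ∧
          IsToricTwoVarLFunctionUpTo₂ C X Y ι' 𝔭 𝔭' κ₁ κ₂ γ₁ γ₂ Dt.f ΩK' L₂)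
    (hJ : Literature.NumberTheory.EllipticCurves.jacquet1972_functionalEquation_rankinSelbergHecke_cone)
    (hNek : Literature.NumberTheory.EllipticCurves.nekovar2006_xGr₂_isTorsion_iff_and_charIdeal_eq_map_inv)
    (hK2 :
        ∀ (W : WeierstrassCurve ℚ) [W.IsElliptic] [W.IsGloballyMinimal] (N : ℕ) [NeZero N] (K : Type) [Field K]
          [NumberField K] (Dt : Literature.NumberTheory.EllipticCurves.ModularForms.ModularParametrizationData W N),
        Summit.BirchSwinnertonDyer.Rank1Residual.Additive.ClassO6 W 3 → W.HasSurjectiveModNGaloisRep 3 →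
        W.analyticRank = 1 → W.conductorNorm ℤ = N → IsImaginaryQuadratic K → SatisfiesHeegnerHypothesis N K →
        ∀ (𝔭 : HeightOneSpectrum (𝓞 K)), ((3 : ℕ) : 𝓞 K) ∈ 𝔭.asIdeal →
          𝔭.asIdeal.ramificationIdx (𝓞 ℚ) = 1 → 𝔭.asIdeal.inertiaDeg (𝓞 ℚ) = 1 →
        ∀ (𝔭' : HeightOneSpectrum (𝓞 K)), ((3 : ℕ) : 𝓞 K) ∈ 𝔭'.asIdeal → 𝔭' ≠ 𝔭 →
        ∀ (ι' : PadicAlgCl 3 ≃+* ℂ), Summit.BirchSwinnertonDyer.BirchSwinnertonDyer.Theorems.SchneiderFree.BranchInducesPrime 3 ι' 𝔭 →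
        ∀ (κ₁ κ₂ : ZpExtension K 3) (γ₁ γ₂ : Field.absoluteGaloisGroup K)
          [Fact (ZpExtension.IsTopGeneratorPair κ₁ κ₂ γ₁ γ₂)],
        (∀ v : HeightOneSpectrum (𝓞 K), v ≠ 𝔭 → ∀ 𝔓 ∈ v.primesAbove,
            𝔓.inertia (Field.absoluteGaloisGroup K) ≤ κ₁.kerSubgroup) →
        Module.Finite (IwasawaAlgebra₂ 3) ((W.baseChange K).XGr₂ 3 κ₁ κ₂ 𝔭' γ₁ γ₂) →
        Module.IsTorsion (IwasawaAlgebra₂ 3) ((W.baseChange K).XGr₂ 3 κ₁ κ₂ 𝔭' γ₁ γ₂) →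
        ∀ (g : IwasawaAlgebra₂ 3),
          Literature.NumberTheory.EllipticCurves.Module.charIdeal (IwasawaAlgebra₂ 3)
            ((W.baseChange K).XGr₂ 3 κ₁ κ₂ 𝔭' γ₁ γ₂) = Ideal.span {g} →
        ∀ (ΩK' : ℂ) (C X Y : ℂ_[3]) (L₂ : PowerSeries (PowerSeries (unrIntegers 3))), ΩK' ≠ 0 → C ≠ 0 → X ≠ 0 → Y ≠ 0 →
          IsToricTwoVarLFunctionUpTo₂ C X Y ι' 𝔭 𝔭' κ₁ κ₂ γ₁ γ₂ Dt.f ΩK' L₂ →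
        ThinCombDvdRat (unrIntegers 3) 3
          (PowerSeries.map (PowerSeries.map (Summit.BirchSwinnertonDyer.Rank1Residual.X11b.Halves.toUnr 3)) g) L₂) :
    Summit.BirchSwinnertonDyer.BirchSwinnertonDyer.Theses.UniversalToricDescent.RationalSplitIMCInclusionAtThree :=
  RationalSplitIMCInclusionAtThree_of_toricExistsSymm_of_nekovar_of_ratCombDvd (toricExistsSymmUpTo2_of_exists_of_jacquet hE hJ) hNek hK2

/-- **(N♭) ⟹ (E)**: the v10 stub `NormalisedToricFrameUpToUnitAtThree` (normalised existence up to `ℤ₃ˣ`, as a text) implies the bare existence (E) —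
take `Y := X·ι′⁻¹(N·|d_K|/4)·u`, which is non-zero. So skeleton v11's stub 1 is WEAKER than v10's. [cite: Hida1988AIF, §5 Thm. 5.1b (shape; nothing asserted)] -/
theorem toricFrameExists_of_normalisedUpToUnit
    (hN :
        ∀ (W : WeierstrassCurve ℚ) [W.IsElliptic] [W.IsGloballyMinimal] (N : ℕ) [NeZero N] (K : Type) [Field K]
          [NumberField K] (Dt : Literature.NumberTheory.EllipticCurves.ModularForms.ModularParametrizationData W N),
        Summit.BirchSwinnertonDyer.Rank1Residual.Additive.ClassO6 W 3 → W.HasSurjectiveModNGaloisRep 3 →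
        W.analyticRank = 1 → W.conductorNorm ℤ = N → IsImaginaryQuadratic K → SatisfiesHeegnerHypothesis N K →
        ∀ (κ' : ZpExtension K 3), κ'.IsAnticyclotomic → ∀ (γ : Field.absoluteGaloisGroup K) [Fact (κ'.IsTopGenerator γ)]
          (𝔭 : HeightOneSpectrum (𝓞 K)), ((3 : ℕ) : 𝓞 K) ∈ 𝔭.asIdeal →
          𝔭.asIdeal.ramificationIdx (𝓞 ℚ) = 1 → 𝔭.asIdeal.inertiaDeg (𝓞 ℚ) = 1 →
        ∀ (𝔭' : HeightOneSpectrum (𝓞 K)), ((3 : ℕ) : 𝓞 K) ∈ 𝔭'.asIdeal → 𝔭' ≠ 𝔭 →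
        ∀ (ι' : PadicAlgCl 3 ≃+* ℂ), Summit.BirchSwinnertonDyer.BirchSwinnertonDyer.Theorems.SchneiderFree.BranchInducesPrime 3 ι' 𝔭 →
        ∀ (κ₁ κ₂ : ZpExtension K 3) (γ₁ γ₂ : Field.absoluteGaloisGroup K) (k : ℕ)
          [Fact (ZpExtension.IsTopGeneratorPair κ₁ κ₂ γ₁ γ₂)],
        (∀ v : HeightOneSpectrum (𝓞 K), v ≠ 𝔭 → ∀ 𝔓 ∈ v.primesAbove,
            𝔓.inertia (Field.absoluteGaloisGroup K) ≤ κ₁.kerSubgroup) →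
        ZpExtension.pairKer κ₁ κ₂ ≤ κ'.kerSubgroup → γ₁ * γ⁻¹ ∈ κ'.kerSubgroup → γ₂ * (γ ^ (3 ^ k))⁻¹ ∈ κ'.kerSubgroup →
        ∃ (ΩK' : ℂ) (C X : ℂ_[3]) (u : ℤ_[3]ˣ) (L₂ : PowerSeries (PowerSeries (unrIntegers 3))),
          ΩK' ≠ 0 ∧ C ≠ 0 ∧ X ≠ 0 ∧
          IsToricTwoVarLFunctionUpTo₂ C X
            (X * (((ι'.symm ((N : ℂ) * ((NumberField.discr K).natAbs : ℂ) / 4) : PadicAlgCl 3)) : ℂ_[3]) *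
              algebraMap ℚ_[3] ℂ_[3] ((u : ℤ_[3]) : ℚ_[3]))
            ι' 𝔭 𝔭' κ₁ κ₂ γ₁ γ₂ Dt.f ΩK' L₂) :
    ∀ (W : WeierstrassCurve ℚ) [W.IsElliptic] [W.IsGloballyMinimal] (N : ℕ) [NeZero N] (K : Type) [Field K]
      [NumberField K] (Dt : Literature.NumberTheory.EllipticCurves.ModularForms.ModularParametrizationData W N),
    Summit.BirchSwinnertonDyer.Rank1Residual.Additive.ClassO6 W 3 → W.HasSurjectiveModNGaloisRep 3 →
    W.analyticRank = 1 → W.conductorNorm ℤ = N → IsImaginaryQuadratic K → SatisfiesHeegnerHypothesis N K →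
    ∀ (κ' : ZpExtension K 3), κ'.IsAnticyclotomic → ∀ (γ : Field.absoluteGaloisGroup K) [Fact (κ'.IsTopGenerator γ)]
      (𝔭 : HeightOneSpectrum (𝓞 K)), ((3 : ℕ) : 𝓞 K) ∈ 𝔭.asIdeal →
      𝔭.asIdeal.ramificationIdx (𝓞 ℚ) = 1 → 𝔭.asIdeal.inertiaDeg (𝓞 ℚ) = 1 →
    ∀ (𝔭' : HeightOneSpectrum (𝓞 K)), ((3 : ℕ) : 𝓞 K) ∈ 𝔭'.asIdeal → 𝔭' ≠ 𝔭 →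
    ∀ (ι' : PadicAlgCl 3 ≃+* ℂ), Summit.BirchSwinnertonDyer.BirchSwinnertonDyer.Theorems.SchneiderFree.BranchInducesPrime 3 ι' 𝔭 →
    ∀ (κ₁ κ₂ : ZpExtension K 3) (γ₁ γ₂ : Field.absoluteGaloisGroup K) (k : ℕ)
      [Fact (ZpExtension.IsTopGeneratorPair κ₁ κ₂ γ₁ γ₂)],
    (∀ v : HeightOneSpectrum (𝓞 K), v ≠ 𝔭 → ∀ 𝔓 ∈ v.primesAbove,
        𝔓.inertia (Field.absoluteGaloisGroup K) ≤ κ₁.kerSubgroup) →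
    ZpExtension.pairKer κ₁ κ₂ ≤ κ'.kerSubgroup → γ₁ * γ⁻¹ ∈ κ'.kerSubgroup → γ₂ * (γ ^ (3 ^ k))⁻¹ ∈ κ'.kerSubgroup →
    ∃ (ΩK' : ℂ) (C X Y : ℂ_[3]) (L₂ : PowerSeries (PowerSeries (unrIntegers 3))),
      ΩK' ≠ 0 ∧ C ≠ 0 ∧ X ≠ 0 ∧ Y ≠ 0 ∧
      IsToricTwoVarLFunctionUpTo₂ C X Y ι' 𝔭 𝔭' κ₁ κ₂ γ₁ γ₂ Dt.f ΩK' L₂ := by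
  intro W _ _ N _ K _ _ Dt hO6 hsurj hrk hN' hK hH κ' hκ' γ hγ 𝔭 h3 hram hdeg 𝔭' h3' hne ι' hι κ₁ κ₂ γ₁ γ₂ k hpair hur₁ hker hγ₁ hγ₂
  obtain ⟨ΩK', C, X, u, L₂, hΩK', hC, hX, hL₂⟩ :=
    hN W N K Dt hO6 hsurj hrk hN' hK hH κ' hκ' γ 𝔭 h3 hram hdeg 𝔭' h3' hne ι' hι κ₁ κ₂ γ₁ γ₂ k hur₁ hker hγ₁ hγ₂
  refine ⟨ΩK', C, X, _, L₂, hΩK', hC, hX, ?_, hL₂⟩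
  have hκc0 : ((N : ℂ) * ((NumberField.discr K).natAbs : ℂ) / 4) ≠ 0 := by
    refine div_ne_zero (mul_ne_zero (by exact_mod_cast NeZero.ne N) ?_) (by norm_num)
    exact_mod_cast Int.natAbs_ne_zero.mpr (NumberField.discr_ne_zero K)
  refine mul_ne_zero (mul_ne_zero hX ?_) ?_
  · rw [PadicComplex.coe_eq]
    exact (map_ne_zero_iff _ (algebraMap (PadicAlgCl 3) ℂ_[3]).injective).mpr ((map_ne_zero_iff _ ι'.symm.injective).mpr hκc0)
  · rw [map_ne_zero_iff _ (algebraMap ℚ_[3] ℂ_[3]).injective]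
    exact PadicInt.coe_ne_zero.mpr (Units.ne_zero u)

end Summit.BirchSwinnertonDyer.BirchSwinnertonDyer.Theorems.UniversalToricDescentRatwallThinCombLine.V87

end
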